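import Mathlib

/-!
# LINE «kernel_budget» — certificate T6a: the shell-weight polynomial inequality (critic idea-crit-8 g4, N103 (4))

The pairing route (module docstring of `Lines/kernel_budget_signlaw.lean`, T6/T8; LINE g7-3 `Lines/l2_budget.lean`, stub T) uses the
explicit weight `w = (interior constant) + K_ĉ` of the test field `K = ℙ(ψ_h ĉ)` for a thin shell `h`; normalised by the interior constant
it equals, at relative inverse distance `u = s/‖y‖ ∈ [0,1]` and `γ = cos²∠(y, ĉ) ∈ [0,1]`,
  `f(u, γ) = 1 − ¾·u·(1 + γ) − ¼·u³·(1 − 3γ)`.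
The route needs: `f ≥ 0` on `[0,1]²` (non-negative weight), `f(1, γ) = 0` (continuity with `w ≡ 0` on the ball), `f` antitone in `u`
(so the weight increases outward), and a positive floor beyond `4s` (`u ≤ 1/4`): `f ≥ 5/8` (the cards quote the weaker `0.3125`).
All four are proved below, sorry-free (the lower bound `0 ≤ γ` is never used: the inequalities hold for all `γ ≤ 1`) — this is the «10-line certificate» asked for in N103; no interval arithmetic needed
(factorisation `f = (1 − u)·(1 + (u + u²)(1 − 3γ)/4)`).  Nothing here is about Navier–Stokes; no summit is proved by a line.
-/

namespace Summit.NavierStokesRegularity.NavierStokesRegularity.Cruxes.NearExtremalTransience.KernelBudget.Weight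

set_option linter.dupNamespace false

/-- The normalised shell weight of the pairing route. -/
noncomputable def f (u γ : ℝ) : ℝ := 1 - 3 / 4 * u * (1 + γ) - 1 / 4 * u ^ 3 * (1 - 3 * γ)

theorem f_factor (u γ : ℝ) : f u γ = (1 - u) * (1 + (u + u ^ 2) * (1 - 3 * γ) / 4) := by
  unfold f; ring

/-- Continuity with the interior (`w ≡ 0` on the ball): `f(1, γ) = 0`. -/
theorem f_one (γ : ℝ) : f 1 γ = 0 := by
  unfold f; ring

/-- Far limit: `f(0, γ) = 1`. -/
theorem f_zero (γ : ℝ) : f 0 γ = 1 := by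
  unfold f; ring

/-- T6a: the weight is non-negative on `[0,1]²`. -/
theorem f_nonneg {u γ : ℝ} (hu0 : 0 ≤ u) (hu1 : u ≤ 1) (_hγ0 : 0 ≤ γ) (hγ1 : γ ≤ 1) : 0 ≤ f u γ := by
  rw [f_factor]
  apply mul_nonneg (by linarith)
  have hp : 0 ≤ u + u ^ 2 := by positivity
  have hp2 : u + u ^ 2 ≤ 2 := by nlinarith
  nlinarith [mul_nonneg hp (show 0 ≤ (1 - 3 * γ) / 4 + 1 / 2 by linarith)]

/-- Positive floor beyond four shell radii (`u ≤ 1/4`): `f ≥ 5/8` (the cards use the weaker constant `0.3125`). -/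
theorem f_ge_floor {u γ : ℝ} (hu0 : 0 ≤ u) (hu1 : u ≤ 1 / 4) (_hγ0 : 0 ≤ γ) (hγ1 : γ ≤ 1) : 5 / 8 ≤ f u γ := by
  rw [f_factor]
  have hp : 0 ≤ u + u ^ 2 := by positivity
  have hp2 : u + u ^ 2 ≤ 5 / 16 := by nlinarith
  have hq : -1 / 2 ≤ (1 - 3 * γ) / 4 := by linarith
  have h2 : 1 - 5 / 32 ≤ 1 + (u + u ^ 2) * (1 - 3 * γ) / 4 := by
    nlinarith [mul_nonneg hp (show 0 ≤ (1 - 3 * γ) / 4 + 1 / 2 by linarith)]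
  have h1 : (3 : ℝ) / 4 ≤ 1 - u := by linarith
  calc (5 : ℝ) / 8 ≤ 3 / 4 * (1 - 5 / 32) := by norm_num
    _ ≤ (1 - u) * (1 + (u + u ^ 2) * (1 - 3 * γ) / 4) :=
        mul_le_mul h1 h2 (by norm_num) (by linarith)

/-- The weight increases outward: `f` is antitone in `u` on `[0,1]` for every `γ ∈ [0,1]`. -/
theorem f_antitone {u₁ u₂ γ : ℝ} (h0 : 0 ≤ u₁) (h12 : u₁ ≤ u₂) (h1 : u₂ ≤ 1) (hγ0 : 0 ≤ γ) (hγ1 : γ ≤ 1) :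
    f u₂ γ ≤ f u₁ γ := by
  have key : f u₁ γ - f u₂ γ =
      (u₂ - u₁) * (3 / 4 * (1 + γ) + 1 / 4 * (1 - 3 * γ) * (u₁ ^ 2 + u₁ * u₂ + u₂ ^ 2)) := by
    unfold f; ring
  have hS0 : 0 ≤ u₁ ^ 2 + u₁ * u₂ + u₂ ^ 2 := by nlinarith [mul_nonneg h0 (h0.trans h12)]
  have hS3 : u₁ ^ 2 + u₁ * u₂ + u₂ ^ 2 ≤ 3 := by nlinarith [mul_nonneg h0 (h0.trans h12)]
  have hb : 0 ≤ 3 / 4 * (1 + γ) + 1 / 4 * (1 - 3 * γ) * (u₁ ^ 2 + u₁ * u₂ + u₂ ^ 2) := by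
    nlinarith [mul_nonneg hS0 (show 0 ≤ 1 / 4 * (1 - 3 * γ) + 1 / 2 by linarith)]
  nlinarith [mul_nonneg (show 0 ≤ u₂ - u₁ by linarith) hb]

/-- `∂γ`-monotonicity used for the floor: `f` is antitone in `γ` on `[0,1]` (`∂_γ f = −¾u(1 − u²) ≤ 0`). -/
theorem f_antitone_gamma {u γ₁ γ₂ : ℝ} (hu0 : 0 ≤ u) (hu1 : u ≤ 1) (h12 : γ₁ ≤ γ₂) : f u γ₂ ≤ f u γ₁ := by
  have key : f u γ₁ - f u γ₂ = 3 / 4 * u * (1 - u ^ 2) * (γ₂ - γ₁) := by unfold f; ring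
  have : 0 ≤ 3 / 4 * u * (1 - u ^ 2) * (γ₂ - γ₁) := by
    apply mul_nonneg (mul_nonneg (by positivity) (by nlinarith)) (by linarith)
  linarith

end Summit.NavierStokesRegularity.NavierStokesRegularity.Cruxes.NearExtremalTransience.KernelBudget.Weight
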